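import Literature.NumberTheory.LFunctions.UnconditionalPairCorrelationTheorem1Proofs
import HarnessLib

/-!
RH-FREE — «nothing here bears on the truth of RH».

# Discharge of `baluyotEtAl2024_lemma5` — pairs of zeros of `ζ` against an even kernel of Fourier
# support `[−1,1]` (Baluyot–Goldston–Suriajaya–Turnage-Butterbaugh, Acta Arith. 214 (2024), Lemma 5)

Topic `Literature/NumberTheory/LFunctions` (namespace `Literature.NumberTheory.LFunctions`, objects in
`BGSTB2024`). PROOF LAYER: theorems only — no definitions, no named facts. Main result:

* `baluyotEtAl2024_lemma5_holds : baluyotEtAl2024_lemma5` — for every real even `r ∈ L¹(ℝ)` supported in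
  `[−1,1]` and Lipschitz at `0`, there are `C, T₀` with
  `‖Σ_{ρ,ρ′: 0<γ,γ′≤T} r̂(i(ρ−ρ′) log T/2π) w(ρ−ρ′) − (T/2π) log T (r(0) + 2∫₀¹ α r(α) dα)‖ ≤ C (T/2π) log T/√log T`
  for `T ≥ T₀` (zeros with multiplicity, UNCONDITIONALLY).

Route = the printed proof (§3, p. 6 of the held text `paper:arxiv-2306.04799`): (3.3)
`r̂(i(ρ−ρ′) log T/2π) = ∫ r(α) T^{α(ρ−ρ′)} dα` (`BGSTB2024.hatC_eq_integral_rpow`), hence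
`Σ r̂(…) w = ∫ r(α) F(T^α,T) dα` (`BGSTB2024.kernelPairSum_eq_integral`, finite Fubini); `F(1/x,T) = F(x,T)`
and the evenness of `r` fold the integral onto `[0,1]`; there the corrected Theorem 1
(`BGSTB2024.pairSum_montgomeryTheorem`, window `0 < γ ≤ T`):
`F(T^α,T) = (T/2π)(T^{−2α} log²T + α log T) + O((T/2π)T^{−2α}log^{3/2}T + T√log T)`; the Lipschitz condition
at `0` gives `2 log T ∫₀¹ r(α)T^{−2α} dα = r(0) + O(1/log T) + O(‖r‖₁ T^{−2δ} log T)` (the source splits at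
`log log T/log T`; a fixed `δ` from the Lipschitz hypothesis suffices), and `∫₀¹ |r(α)| T^{−2α} dα =
O(1/log T) + O(‖r‖₁ T^{−2δ})` absorbs the `log^{3/2}` error term. Status note (no endorsement): Lemma 5 of
a refereed paper (Acta Arith. 2024); its input Theorem 1 was corrected by the authors in arXiv:2501.14545 §2
("all the applications of Theorem 1 in [BGST-PC], such as Lemma 5 and Lemma 7, remain correct"), and the
proof here uses only the corrected error terms. Nothing here bears on the truth of RH.

## References

* [BaluyotEtAl2024] Acta Arith. 214 (2024) 357–376 = arXiv:2306.04799: §3, (3.1)–(3.5), Lemma 5 and its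
  proof (held text `paper:arxiv-2306.04799`, p0006).
* [BaluyotEtAl2025] arXiv:2501.14545, §2 (MT) (the corrected Theorem 1).
-/

noncomputable section

open Complex Filter Set MeasureTheory intervalIntegral Asymptotics
open scoped Real Topology ComplexConjugate

namespace Literature.NumberTheory.LFunctions

namespace BGSTB2024

open Montgomery

/-! ## §1. `r̂(i(ρ−ρ′) log T/2π) = ∫ r(α) T^{α(ρ−ρ′)} dα` ((3.3) of the source) -/

/-- `(T^a)^s = exp(a log T · s)` for `T > 0`, real `a` and complex `s`. [folklore] -/
private theorem rpow_cpow_eq_exp {T : ℝ} (hT : 0 < T) (a : ℝ) (s : ℂ) :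
    ((T ^ a : ℝ) : ℂ) ^ s = Complex.exp (((a * Real.log T : ℝ) : ℂ) * s) := by
  have hTa : 0 < T ^ a := Real.rpow_pos_of_pos hT a
  rw [Complex.cpow_def_of_ne_zero (Complex.ofReal_ne_zero.2 hTa.ne'), ← Complex.ofReal_log hTa.le,
    Real.log_rpow hT]

/-- The exponential of (3.1) at `z = i s log T/2π`: `e(−zα) = T^{αs}`.
[cite: BaluyotEtAl2024, §3 («Taking z = i(ρ−ρ′) log T/2π»)] -/
theorem exp_hatC_kernel_eq {T : ℝ} (hT : 0 < T) (s : ℂ) (a : ℝ) :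
    Complex.exp (-(2 * Real.pi * I) * (I * s * (Real.log T / (2 * Real.pi))) * a) =
      ((T ^ a : ℝ) : ℂ) ^ s := by
  rw [rpow_cpow_eq_exp hT]
  congr 1
  have hπ : (2 * (Real.pi : ℂ)) ≠ 0 := mul_ne_zero two_ne_zero (Complex.ofReal_ne_zero.2 Real.pi_ne_zero)
  have hI : I * I = -1 := Complex.I_mul_I
  push_cast
  calc -(2 * (Real.pi : ℂ) * I) * (I * s * ((Real.log T : ℂ) / (2 * Real.pi))) * (a : ℂ)
      = -(I * I) * ((2 * (Real.pi : ℂ)) / (2 * Real.pi)) * ((a : ℂ) * Real.log T * s) := by ring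
    _ = (a : ℂ) * Real.log T * s := by rw [hI, div_self hπ]; ring

/-- **(3.3), pointwise**: `r̂(i s log T/2π) = ∫ r(α) T^{αs} dα` (`T > 0`).
[cite: BaluyotEtAl2024, §3 («Taking z = i(ρ−ρ′) log T/2π, we have ĝ(…) = ∫ g(α)T^{α(ρ−ρ′)} dα»)] -/
theorem hatC_eq_integral_rpow (r : ℝ → ℝ) {T : ℝ} (hT : 0 < T) (s : ℂ) :
    hatC r (I * s * (Real.log T / (2 * Real.pi))) = ∫ a : ℝ, (r a : ℂ) * ((T ^ a : ℝ) : ℂ) ^ s := by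
  unfold hatC
  congr 1
  funext a
  rw [exp_hatC_kernel_eq hT s a]

/-- `a ↦ T^{a s}` is continuous. [folklore] -/
private theorem continuous_rpow_cpow {T : ℝ} (hT : 0 < T) (s : ℂ) :
    Continuous fun a : ℝ ↦ ((T ^ a : ℝ) : ℂ) ^ s := by
  have : (fun a : ℝ ↦ ((T ^ a : ℝ) : ℂ) ^ s) = fun a ↦ Complex.exp (((a * Real.log T : ℝ) : ℂ) * s) :=
    funext fun a ↦ rpow_cpow_eq_exp hT a s
  rw [this]
  fun_prop

/-- `‖T^{a s}‖ ≤ T` for `T ≥ 1`, `|a| ≤ 1`, `|Re s| ≤ 1`. [folklore] -/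
private theorem norm_rpow_cpow_le {T : ℝ} (hT : 1 ≤ T) {a : ℝ} (ha : |a| ≤ 1) {s : ℂ} (hs : |s.re| ≤ 1) :
    ‖((T ^ a : ℝ) : ℂ) ^ s‖ ≤ T := by
  have hT0 : 0 < T := by linarith
  rw [Complex.norm_cpow_eq_rpow_re_of_pos (Real.rpow_pos_of_pos hT0 a), ← Real.rpow_mul hT0.le]
  have h1 : a * s.re ≤ 1 := by
    calc a * s.re ≤ |a * s.re| := le_abs_self _
      _ = |a| * |s.re| := abs_mul _ _
      _ ≤ 1 * 1 := mul_le_mul ha hs (abs_nonneg _) zero_le_one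
      _ = 1 := one_mul _
  calc T ^ (a * s.re) ≤ T ^ (1 : ℝ) := Real.rpow_le_rpow_of_exponent_le hT h1
    _ = T := Real.rpow_one T

/-- A function supported in `[−1,1]` vanishes where `|a| > 1`. [folklore] -/
private theorem eq_zero_of_one_lt_abs {r : ℝ → ℝ} (hsupp : Function.support r ⊆ Set.Icc (-1) 1)
    {a : ℝ} (ha : 1 < |a|) : r a = 0 := by
  by_contra h
  have hmem := hsupp (Function.mem_support.2 h)
  rw [Set.mem_Icc, ← abs_le] at hmem
  exact absurd hmem (not_le.2 ha)

/-- Integrability of `α ↦ r(α) T^{αs}` for `r ∈ L¹` supported in `[−1,1]`, `T ≥ 1`, `|Re s| ≤ 1`.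
[cite: BaluyotEtAl2024, §3 (3.1) («ĝ(z) is an analytic function for all z»)] -/
theorem integrable_mul_rpow_cpow {r : ℝ → ℝ} (hr : Integrable r)
    (hsupp : Function.support r ⊆ Set.Icc (-1) 1) {T : ℝ} (hT : 1 ≤ T) {s : ℂ} (hs : |s.re| ≤ 1) :
    Integrable fun a : ℝ ↦ (r a : ℂ) * ((T ^ a : ℝ) : ℂ) ^ s := by
  have hT0 : 0 < T := by linarith
  refine Integrable.mono' (hr.norm.const_mul T) ?_ (ae_of_all _ fun a ↦ ?_)
  · exact (Complex.continuous_ofReal.comp_aestronglyMeasurable hr.aestronglyMeasurable).mul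
      (continuous_rpow_cpow hT0 s).aestronglyMeasurable
  · rw [norm_mul, Complex.norm_real, mul_comm]
    by_cases ha : |a| ≤ 1
    · exact mul_le_mul_of_nonneg_right (norm_rpow_cpow_le hT ha hs) (norm_nonneg _)
    · have h0 : r a = 0 := eq_zero_of_one_lt_abs hsupp (not_le.1 ha)
      simp [h0]

/-- Two zeros of the box have real parts within `1` of each other. [folklore] -/
private theorem abs_re_sub_le_one {T : ℝ} {ρ ρ' : ℂ} (hρ : ρ ∈ zerosUpTo T) (hρ' : ρ' ∈ zerosUpTo T) :
    |(ρ - ρ').re| ≤ 1 := by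
  rw [mem_zerosUpTo] at hρ hρ'
  obtain ⟨-, h0, h1, -, -⟩ := hρ
  obtain ⟨-, h0', h1', -, -⟩ := hρ'
  rw [Complex.sub_re, abs_le]
  constructor <;> linarith

/-- Integrability of one term of `∫ r(α) F(T^α,T) dα`. [cite: BaluyotEtAl2024, §3 (3.3)] -/
private theorem integrable_term {r : ℝ → ℝ} (hr : Integrable r)
    (hsupp : Function.support r ⊆ Set.Icc (-1) 1) {T : ℝ} (hT : 1 ≤ T) {ρ ρ' : ℂ}
    (hρ : ρ ∈ zerosUpTo T) (hρ' : ρ' ∈ zerosUpTo T) :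
    Integrable fun a : ℝ ↦ (r a : ℂ) *
      ((mult ρ : ℂ) * (mult ρ' : ℂ) * (((T ^ a : ℝ) : ℂ) ^ (ρ - ρ') * weight (ρ - ρ'))) := by
  have h := (integrable_mul_rpow_cpow hr hsupp hT (abs_re_sub_le_one hρ hρ')).mul_const
    ((mult ρ : ℂ) * (mult ρ' : ℂ) * weight (ρ - ρ'))
  refine h.congr (ae_of_all _ fun a ↦ ?_)
  simp only
  ring

/-- **Integrability of `α ↦ r(α) F(T^α, T)`** (`r ∈ L¹` supported in `[−1,1]`, `T ≥ 1`).
[cite: BaluyotEtAl2024, §3 (3.3)] -/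
theorem integrable_mul_pairSum_rpow {r : ℝ → ℝ} (hr : Integrable r)
    (hsupp : Function.support r ⊆ Set.Icc (-1) 1) {T : ℝ} (hT : 1 ≤ T) :
    Integrable fun a : ℝ ↦ (r a : ℂ) * pairSum (T ^ a) T := by
  have e : (fun a : ℝ ↦ (r a : ℂ) * pairSum (T ^ a) T) = fun a ↦
      ∑ ρ ∈ zerosUpTo T, ∑ ρ' ∈ zerosUpTo T, (r a : ℂ) *
        ((mult ρ : ℂ) * (mult ρ' : ℂ) * (((T ^ a : ℝ) : ℂ) ^ (ρ - ρ') * weight (ρ - ρ'))) := by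
    funext a
    simp only [pairSum, pairSumWith, Finset.mul_sum]
  rw [e]
  exact integrable_finsetSum _ fun ρ hρ ↦ integrable_finsetSum _ fun ρ' hρ' ↦
    integrable_term hr hsupp hT hρ hρ'

/-- **(3.3)**: `Σ_{ρ,ρ′: 0<γ,γ′≤T} r̂(i(ρ−ρ′) log T/2π) w(ρ−ρ′) = ∫ r(α) F(T^α,T) dα` (zeros with
multiplicity; `r ∈ L¹` supported in `[−1,1]`, `T ≥ 1`; the source writes the right side as
`(T/2π) log T ∫ F(α) r(α) dα` with `F(α) = ((T/2π) log T)⁻¹ F(T^α,T)`).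
[cite: BaluyotEtAl2024, §3 (3.3)] -/
theorem kernelPairSum_eq_integral {r : ℝ → ℝ} (hr : Integrable r)
    (hsupp : Function.support r ⊆ Set.Icc (-1) 1) {T : ℝ} (hT : 1 ≤ T) :
    kernelPairSum r T = ∫ a : ℝ, (r a : ℂ) * pairSum (T ^ a) T := by
  have hT0 : 0 < T := by linarith
  simp only [kernelPairSum, pairSum, pairSumWith]
  simp_rw [Finset.mul_sum]
  rw [integral_finsetSum _ (fun ρ hρ ↦ integrable_finsetSum _ fun ρ' hρ' ↦
    integrable_term hr hsupp hT hρ hρ')]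
  refine Finset.sum_congr rfl fun ρ hρ ↦ ?_
  rw [integral_finsetSum _ (fun ρ' hρ' ↦ integrable_term hr hsupp hT hρ hρ')]
  refine Finset.sum_congr rfl fun ρ' _ ↦ ?_
  rw [hatC_eq_integral_rpow r hT0 (ρ - ρ'), ← MeasureTheory.integral_mul_const,
    ← MeasureTheory.integral_const_mul]
  congr 1
  funext a
  ring

/-- `F(T^{−a},T) = F(T^a,T)` (`F(1/x,T) = F(x,T)`). [cite: BaluyotEtAl2024, §2 («F(1/x,T) = F(x,T)»)] -/
theorem pairSum_rpow_neg {T : ℝ} (hT : 0 < T) (a : ℝ) : pairSum (T ^ (-a)) T = pairSum (T ^ a) T := by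
  rw [Real.rpow_neg hT.le, ← one_div]
  exact pairSum_inv (Real.rpow_pos_of_pos hT a) T

/-! ## §2. Elementary integrals -/

/-- For an even `h` vanishing on `(1,∞)` and integrable on `[0,1]`: `∫_ℝ h = 2∫₀¹ h`.
[folklore] -/
private theorem integral_eq_two_mul_of_even {h : ℝ → ℝ} (heven : ∀ a, h (-a) = h a)
    (hzero : ∀ a, 1 < a → h a = 0) (hI : IntervalIntegrable h volume 0 1) :
    ∫ a, h a = 2 * ∫ a in (0 : ℝ)..1, h a := by
  have habs : ∀ a : ℝ, h |a| = h a := fun a ↦ by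
    rcases le_or_gt 0 a with ha | ha
    · rw [abs_of_nonneg ha]
    · rw [abs_of_neg ha, heven]
  have h1 : ∫ a, h a = 2 * ∫ a in Set.Ioi (0 : ℝ), h a := by
    have := integral_comp_abs (f := h)
    simp_rw [habs] at this
    exact this
  have hI2 : IntegrableOn h (Set.Ioi 1) :=
    integrableOn_zero.congr_fun (fun a ha ↦ (hzero a ha).symm) measurableSet_Ioi
  have h2 : ∫ a in Set.Ioi (0 : ℝ), h a = ∫ a in Set.Ioc (0 : ℝ) 1, h a := by
    rw [← Set.Ioc_union_Ioi_eq_Ioi zero_le_one, setIntegral_union Set.Ioc_disjoint_Ioi_same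
      measurableSet_Ioi hI.1 hI2,
      setIntegral_eq_zero_of_forall_eq_zero (t := Set.Ioi 1) fun a (ha : a ∈ Set.Ioi 1) ↦ hzero a ha,
      add_zero]
  rw [h1, h2, intervalIntegral.integral_of_le zero_le_one]

/-- `∫₀^d e^{−Ma} da = (1 − e^{−Md})/M` (`M ≠ 0`). [folklore] -/
private theorem integral_exp_neg_mul_eq {M : ℝ} (hM : M ≠ 0) (d : ℝ) :
    ∫ a in (0 : ℝ)..d, Real.exp (-(M * a)) = (1 - Real.exp (-(M * d))) / M := by
  have h : ∀ a ∈ Set.uIcc 0 d,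
      HasDerivAt (fun a : ℝ ↦ Real.exp (-(M * a)) / (-M)) (Real.exp (-(M * a))) a := by
    intro a _
    have h1 : HasDerivAt (fun a : ℝ ↦ -(M * a)) (-M) a := by
      simpa using (hasDerivAt_id a).const_mul (-M)
    have h3 := h1.exp.div_const (-M)
    have e : Real.exp (-(M * a)) * -M / -M = Real.exp (-(M * a)) := by
      rw [mul_div_assoc, div_self (neg_ne_zero.mpr hM), mul_one]
    rw [e] at h3
    exact h3
  rw [intervalIntegral.integral_eq_sub_of_hasDerivAt h
    ((by fun_prop : Continuous fun a : ℝ ↦ Real.exp (-(M * a))).intervalIntegrable _ _)]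
  simp only [mul_zero, neg_zero, Real.exp_zero]
  field_simp
  ring

/-- `∫₀^d e^{−Ma} da ≤ 1/M` (`M > 0`). [folklore] -/
private theorem integral_exp_neg_mul_le {M : ℝ} (hM : 0 < M) (d : ℝ) :
    ∫ a in (0 : ℝ)..d, Real.exp (-(M * a)) ≤ 1 / M := by
  rw [integral_exp_neg_mul_eq hM.ne']
  apply div_le_div_of_nonneg_right _ hM.le
  linarith [Real.exp_pos (-(M * d))]

/-- `a e^{−2Ma} ≤ e^{−Ma}/M` for `a ≥ 0`, `M > 0` (`Ma ≤ e^{Ma}`). [folklore] -/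
private theorem mul_exp_neg_two_mul_le {M : ℝ} (hM : 0 < M) (a : ℝ) :
    a * Real.exp (-(2 * M * a)) ≤ Real.exp (-(M * a)) / M := by
  have h1 : M * a ≤ Real.exp (M * a) := by linarith [Real.add_one_le_exp (M * a)]
  have h2 : Real.exp (-(2 * M * a)) = Real.exp (-(M * a)) * Real.exp (-(M * a)) := by
    rw [← Real.exp_add]; ring_nf
  have h4 : 0 < Real.exp (-(M * a)) := Real.exp_pos _
  have h3 : M * a * Real.exp (-(M * a)) ≤ 1 := by
    rw [Real.exp_neg, mul_inv_le_iff₀ (Real.exp_pos _)]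
    simpa using h1
  rw [h2, le_div_iff₀ hM]
  nlinarith [mul_le_mul_of_nonneg_right h3 h4.le]

/-- `∫₀¹ a e^{−2Ma} da ≤ 1/M²` (`M > 0`). [folklore] -/
private theorem integral_mul_exp_neg_le {M : ℝ} (hM : 0 < M) :
    ∫ a in (0 : ℝ)..1, a * Real.exp (-(2 * M * a)) ≤ 1 / M ^ 2 := by
  calc ∫ a in (0 : ℝ)..1, a * Real.exp (-(2 * M * a))
      ≤ ∫ a in (0 : ℝ)..1, Real.exp (-(M * a)) / M :=
        intervalIntegral.integral_mono_on zero_le_one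
          ((by fun_prop : Continuous fun a : ℝ ↦ a * Real.exp (-(2 * M * a))).intervalIntegrable _ _)
          ((by fun_prop : Continuous fun a : ℝ ↦ Real.exp (-(M * a)) / M).intervalIntegrable _ _)
          fun a _ ↦ mul_exp_neg_two_mul_le hM a
    _ = (∫ a in (0 : ℝ)..1, Real.exp (-(M * a))) / M := intervalIntegral.integral_div _ _
    _ ≤ (1 / M) / M := div_le_div_of_nonneg_right (integral_exp_neg_mul_le hM 1) hM.le
    _ = 1 / M ^ 2 := by rw [sq, div_div]

/-- `L² e^{−2δL} ≤ 1` once `L ≥ 4/δ³` (`e^y ≥ (y/3)³`). [folklore] -/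
private theorem sq_mul_exp_neg_le_one {δ L : ℝ} (hδ : 0 < δ) (hL0 : 0 ≤ L) (hL : 4 / δ ^ 3 ≤ L) :
    L ^ 2 * Real.exp (-(2 * δ * L)) ≤ 1 := by
  set y : ℝ := 2 * δ * L with hy
  have hy0 : 0 ≤ y := by positivity
  have h1 : y / 3 + 1 ≤ Real.exp (y / 3) := Real.add_one_le_exp _
  have h2 : (y / 3 + 1) ^ 3 ≤ Real.exp (y / 3) ^ 3 := pow_le_pow_left₀ (by positivity) h1 3
  have h3 : Real.exp (y / 3) ^ 3 = Real.exp y := by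
    rw [← Real.exp_nat_mul]; congr 1; push_cast; ring
  have h4 : (y / 3) ^ 3 ≤ (y / 3 + 1) ^ 3 := pow_le_pow_left₀ (by positivity) (by linarith) 3
  have hδ3 : 0 < δ ^ 3 := pow_pos hδ 3
  have h6 : 4 ≤ L * δ ^ 3 := (div_le_iff₀ hδ3).1 hL
  have h5 : L ^ 2 ≤ (y / 3) ^ 3 := by
    have e : (y / 3) ^ 3 = 8 * δ ^ 3 * L ^ 3 / 27 := by rw [hy]; ring
    rw [e, le_div_iff₀ (by norm_num : (0 : ℝ) < 27)]
    nlinarith [mul_nonneg (sub_nonneg.2 h6) (sq_nonneg L)]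
  rw [Real.exp_neg, mul_inv_le_iff₀ (Real.exp_pos y), one_mul]
  linarith [h5, h4, h2, h3]

/-- `‖z − m‖ = |Re z − m|` for real `z` (`Im z = 0`) and real `m`. [folklore] -/
private theorem norm_sub_ofReal_eq'' {z : ℂ} (hz : z.im = 0) (m : ℝ) : ‖z - (m : ℂ)‖ = |z.re - m| := by
  have : z = (z.re : ℂ) := Complex.ext (by simp) (by simp [hz])
  rw [this, ← Complex.ofReal_sub, Complex.norm_real, Real.norm_eq_abs, Complex.ofReal_re]

/-! ## §3. The estimate on `[0,1]` (the Lipschitz step of the printed proof) -/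

/-- **The analytic core of Lemma 5 on `[0,1]`.** With `u(a) = e^{−2La} = T^{−2a}`, `sL = √L`,
`Q = T/2π`: if `|G(a) − Q(L²u(a) + aL)| ≤ C_M (Q L sL u(a) + T sL)` on `[0,1]` (the corrected Montgomery
theorem at `x = T^a`) and `r` is Lipschitz at `0` with constant `Cℓ` on `|a| < δ`, then
`|2∫₀¹ r G − Q L (r(0) + 2∫₀¹ a r(a) da)| ≤ C · Q sL` with
`C = C_M(|r(0)| + 2Cℓ + 2‖r‖₁ + 4π‖r‖₁) + 2Cℓ + 2‖r‖₁ + 3|r(0)|` (`‖r‖₁ = ∫₀¹|r|`), provided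
`L² e^{−2δL} ≤ 1` and `sL e^{−2L} ≤ 1`. ("we use the Lipschitz condition on `r(α)` at `α = 0` to see the
first integral is `r(0) + O(…)`".) [cite: BaluyotEtAl2024, Lemma 5 (proof)] -/
theorem lemma5_core {r G u : ℝ → ℝ} {Cℓ δ CM Q L sL T uδ : ℝ}
    (hCℓ0 : 0 ≤ Cℓ) (hCM0 : 0 ≤ CM) (hQ0 : 0 < Q) (hL0 : 0 < L) (hsL0 : 0 < sL)
    (hsL2 : sL ^ 2 = L) (hsL1 : 1 ≤ sL) (hsLL : sL ≤ L) (hTQ : T = 2 * Real.pi * Q)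
    (huδ : uδ = Real.exp (-(2 * δ * L))) (hexp1 : L ^ 2 * uδ ≤ 1)
    (hexp3 : sL * Real.exp (-(2 * L)) ≤ 1) (hu : u = fun a ↦ Real.exp (-(2 * L * a)))
    (hLip : ∀ a : ℝ, |a| < δ → |r a - r 0| ≤ Cℓ * |a|)
    (hrI : IntervalIntegrable r volume 0 1)
    (hh₁I : IntervalIntegrable (fun a : ℝ ↦ r a * G a) volume 0 1)
    (hMTa : ∀ a ∈ Set.Icc (0 : ℝ) 1,
      |G a - Q * (L ^ 2 * u a + a * L)| ≤ CM * (Q * L * sL * u a + T * sL)) :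
    |2 * (∫ a in (0 : ℝ)..1, r a * G a) - Q * L * (r 0 + 2 * ∫ a in (0 : ℝ)..1, a * r a)| ≤
      (CM * (|r 0| + 2 * Cℓ + 2 * (∫ a in (0 : ℝ)..1, |r a|) +
          4 * Real.pi * (∫ a in (0 : ℝ)..1, |r a|)) + 2 * Cℓ + 2 * (∫ a in (0 : ℝ)..1, |r a|) +
        3 * |r 0|) * (Q * sL) := by
  have hπ0 : 0 < Real.pi := Real.pi_pos
  have hT0 : 0 < T := by rw [hTQ]; positivity
  -- the pieces of `r` on `[0,1]`
  have habsI : IntervalIntegrable (fun a ↦ |r a|) volume 0 1 := hrI.abs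
  have harI : IntervalIntegrable (fun a : ℝ ↦ a * r a) volume 0 1 :=
    hrI.continuousOn_mul continuousOn_id
  set R₁ : ℝ := ∫ a in (0 : ℝ)..1, |r a| with hR₁
  have hR₁0 : 0 ≤ R₁ := intervalIntegral.integral_nonneg zero_le_one fun a _ ↦ abs_nonneg _
  set I₁ : ℝ := ∫ a in (0 : ℝ)..1, a * r a with hI₁
  set J : ℝ := ∫ a in (0 : ℝ)..1, r a * G a with hJ
  clear_value R₁ I₁ J
  -- `u`
  have hu0 : ∀ a, 0 < u a := fun a ↦ by rw [hu]; exact Real.exp_pos _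
  have huδ0 : 0 < uδ := by rw [huδ]; exact Real.exp_pos _
  have huδle : ∀ a : ℝ, δ ≤ a → u a ≤ uδ := fun a ha ↦ by
    rw [hu, huδ]
    exact Real.exp_le_exp.2 (by nlinarith only [ha, hL0.le])
  have huc : Continuous u := by rw [hu]; fun_prop
  have hauc : Continuous fun a : ℝ ↦ a * u a := continuous_id.mul huc
  have huI : IntervalIntegrable u volume 0 1 := huc.intervalIntegrable _ _
  have hauI : IntervalIntegrable (fun a : ℝ ↦ a * u a) volume 0 1 := hauc.intervalIntegrable _ _
  -- the two Lipschitz splittings on `[0,1]`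
  have haux1 : ∀ a ∈ Set.Icc (0 : ℝ) 1,
      |r a| * u a ≤ |r 0| * u a + Cℓ * (a * u a) + |r a| * uδ := by
    intro a ha
    have hua := (hu0 a).le
    rcases lt_or_ge a δ with had | had
    · have h1 : |r a| ≤ |r 0| + Cℓ * a := by
        have h2 := hLip a (by rw [abs_of_nonneg ha.1]; exact had)
        rw [abs_of_nonneg ha.1] at h2
        have h5 := abs_sub_abs_le_abs_sub (r a) (r 0)
        linarith only [h2, h5]
      have h3 : 0 ≤ |r a| * uδ := mul_nonneg (abs_nonneg _) huδ0.le
      have h4 := mul_le_mul_of_nonneg_right h1 hua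
      have e : (|r 0| + Cℓ * a) * u a = |r 0| * u a + Cℓ * (a * u a) := by ring
      linarith only [h3, h4, e]
    · have h1 : |r a| * u a ≤ |r a| * uδ := mul_le_mul_of_nonneg_left (huδle a had) (abs_nonneg _)
      have h2 : 0 ≤ |r 0| * u a := mul_nonneg (abs_nonneg _) hua
      have h3 : 0 ≤ Cℓ * (a * u a) := mul_nonneg hCℓ0 (mul_nonneg ha.1 hua)
      linarith only [h1, h2, h3]
  have haux2 : ∀ a ∈ Set.Icc (0 : ℝ) 1,
      |r a - r 0| * u a ≤ Cℓ * (a * u a) + (|r a| + |r 0|) * uδ := by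
    intro a ha
    have hua := (hu0 a).le
    rcases lt_or_ge a δ with had | had
    · have h2 := hLip a (by rw [abs_of_nonneg ha.1]; exact had)
      rw [abs_of_nonneg ha.1] at h2
      have h3 : 0 ≤ (|r a| + |r 0|) * uδ := by positivity
      have h4 := mul_le_mul_of_nonneg_right h2 hua
      have e : Cℓ * a * u a = Cℓ * (a * u a) := by ring
      linarith only [h3, h4, e]
    · have h1 : |r a - r 0| ≤ |r a| + |r 0| := abs_sub _ _
      have h4 : |r a - r 0| * u a ≤ (|r a| + |r 0|) * uδ :=
        mul_le_mul h1 (huδle a had) hua (by positivity)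
      have h3 : 0 ≤ Cℓ * (a * u a) := mul_nonneg hCℓ0 (mul_nonneg ha.1 hua)
      linarith only [h3, h4]
  -- the integrand `I` and its majorant `Φ` on `[0,1]`
  set A₁ : ℝ := CM * Q * L * sL * |r 0| with hA₁
  set A₂ : ℝ := CM * Q * L * sL * Cℓ + Q * L ^ 2 * Cℓ with hA₂
  set A₃ : ℝ := CM * Q * L * sL * uδ + CM * T * sL + Q * L ^ 2 * uδ with hA₃
  set A₄ : ℝ := Q * L ^ 2 * |r 0| * uδ with hA₄
  have hA₁0 : 0 ≤ A₁ := by rw [hA₁]; positivity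
  have hA₂0 : 0 ≤ A₂ := by rw [hA₂]; positivity
  have hA₃0 : 0 ≤ A₃ := by rw [hA₃]; positivity
  have hA₄0 : 0 ≤ A₄ := by rw [hA₄]; positivity
  clear_value A₁ A₂ A₃ A₄
  have hpt : ∀ a ∈ Set.Icc (0 : ℝ) 1,
      |r a * G a - r 0 * Q * L ^ 2 * u a - Q * L * (a * r a)| ≤
        A₁ * u a + A₂ * (a * u a) + A₃ * |r a| + A₄ := by
    intro a ha
    have hua := (hu0 a).le
    have eI : r a * G a - r 0 * Q * L ^ 2 * u a - Q * L * (a * r a) =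
        r a * (G a - Q * (L ^ 2 * u a + a * L)) + (r a - r 0) * (Q * L ^ 2 * u a) := by ring
    have e1 : |r a * G a - r 0 * Q * L ^ 2 * u a - Q * L * (a * r a)| ≤
        |r a| * (CM * (Q * L * sL * u a + T * sL)) + |r a - r 0| * (Q * L ^ 2 * u a) := by
      rw [eI]
      refine (abs_add_le _ _).trans (add_le_add ?_ ?_)
      · rw [abs_mul]
        exact mul_le_mul_of_nonneg_left (hMTa a ha) (abs_nonneg _)
      · rw [abs_mul, abs_of_nonneg (by positivity : 0 ≤ Q * L ^ 2 * u a)]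
    have e2 := mul_le_mul_of_nonneg_left (haux1 a ha) (by positivity : 0 ≤ CM * Q * L * sL)
    have e3 := mul_le_mul_of_nonneg_left (haux2 a ha) (by positivity : 0 ≤ Q * L ^ 2)
    have e4 : |r a| * (CM * (Q * L * sL * u a + T * sL)) + |r a - r 0| * (Q * L ^ 2 * u a) =
        CM * Q * L * sL * (|r a| * u a) + CM * T * sL * |r a| + Q * L ^ 2 * (|r a - r 0| * u a) := by
      ring
    have e5 : CM * Q * L * sL * (|r 0| * u a + Cℓ * (a * u a) + |r a| * uδ) + CM * T * sL * |r a| +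
        Q * L ^ 2 * (Cℓ * (a * u a) + (|r a| + |r 0|) * uδ) =
        A₁ * u a + A₂ * (a * u a) + A₃ * |r a| + A₄ := by
      rw [hA₁, hA₂, hA₃, hA₄]; ring
    linarith only [e1, e2, e3, e4, e5]
  -- integrability on `[0,1]`
  have hII : IntervalIntegrable
      (fun a : ℝ ↦ r a * G a - r 0 * Q * L ^ 2 * u a - Q * L * (a * r a)) volume 0 1 :=
    (hh₁I.sub (huI.const_mul _)).sub (harI.const_mul _)
  have hΦI : IntervalIntegrable
      (fun a : ℝ ↦ A₁ * u a + A₂ * (a * u a) + A₃ * |r a| + A₄) volume 0 1 :=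
    (((huI.const_mul _).add (hauI.const_mul _)).add (habsI.const_mul _)).add
      intervalIntegrable_const
  -- the elementary integrals
  set U₀ : ℝ := ∫ a in (0 : ℝ)..1, u a with hU₀
  set U₁ : ℝ := ∫ a in (0 : ℝ)..1, a * u a with hU₁
  have hU₀eq : 2 * L * U₀ = 1 - Real.exp (-(2 * L)) := by
    have h := integral_exp_neg_mul_eq (M := 2 * L) (by positivity) 1
    rw [mul_one] at h
    rw [hU₀, hu, h]
    field_simp
  have hU₀0 : 0 ≤ U₀ := intervalIntegral.integral_nonneg zero_le_one fun a _ ↦ (hu0 a).le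
  have hU₀le : 2 * L * U₀ ≤ 1 := by rw [hU₀eq]; linarith only [Real.exp_pos (-(2 * L))]
  have hU₁0 : 0 ≤ U₁ :=
    intervalIntegral.integral_nonneg zero_le_one fun a ha ↦ mul_nonneg ha.1 (hu0 a).le
  have hU₁le : L ^ 2 * U₁ ≤ 1 := by
    have h := integral_mul_exp_neg_le hL0
    have hL2 : 0 < L ^ 2 := by positivity
    rw [hU₁, hu]
    calc L ^ 2 * ∫ a in (0 : ℝ)..1, a * Real.exp (-(2 * L * a)) ≤ L ^ 2 * (1 / L ^ 2) :=
          mul_le_mul_of_nonneg_left h hL2.le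
      _ = 1 := by field_simp
  clear_value U₀ U₁
  -- `∫₀¹ I` and `∫₀¹ Φ`
  have hIint : ∫ a in (0 : ℝ)..1, (r a * G a - r 0 * Q * L ^ 2 * u a - Q * L * (a * r a)) =
      J - r 0 * Q * L ^ 2 * U₀ - Q * L * I₁ := by
    rw [intervalIntegral.integral_sub (hh₁I.sub (huI.const_mul _)) (harI.const_mul _),
      intervalIntegral.integral_sub hh₁I (huI.const_mul _), intervalIntegral.integral_const_mul,
      intervalIntegral.integral_const_mul, hJ, hU₀, hI₁]
  have hΦint : ∫ a in (0 : ℝ)..1, (A₁ * u a + A₂ * (a * u a) + A₃ * |r a| + A₄) =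
      A₁ * U₀ + A₂ * U₁ + A₃ * R₁ + A₄ := by
    rw [intervalIntegral.integral_add (((huI.const_mul _).add (hauI.const_mul _)).add
        (habsI.const_mul _)) intervalIntegrable_const,
      intervalIntegral.integral_add ((huI.const_mul _).add (hauI.const_mul _)) (habsI.const_mul _),
      intervalIntegral.integral_add (huI.const_mul _) (hauI.const_mul _),
      intervalIntegral.integral_const_mul, intervalIntegral.integral_const_mul,
      intervalIntegral.integral_const_mul, intervalIntegral.integral_const, hU₀, hU₁, hR₁]
    simp
  have hIle : |J - r 0 * Q * L ^ 2 * U₀ - Q * L * I₁| ≤ A₁ * U₀ + A₂ * U₁ + A₃ * R₁ + A₄ := by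
    rw [← hIint, ← hΦint]
    have h := intervalIntegral.norm_integral_le_of_norm_le zero_le_one
      (f := fun a : ℝ ↦ r a * G a - r 0 * Q * L ^ 2 * u a - Q * L * (a * r a))
      (g := fun a : ℝ ↦ A₁ * u a + A₂ * (a * u a) + A₃ * |r a| + A₄) (μ := volume)
      (ae_of_all _ fun a ha ↦ ?_) hΦI
    · rw [Real.norm_eq_abs] at h
      exact h
    · rw [Real.norm_eq_abs]
      exact hpt a (Set.Ioc_subset_Icc_self ha)
  -- the deviation `D = 2J − Q L (r 0 + 2 I₁) = 2∫₀¹ I − r(0) Q L e^{−2L}`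
  have hD : 2 * J - Q * L * (r 0 + 2 * I₁) =
      2 * (J - r 0 * Q * L ^ 2 * U₀ - Q * L * I₁) - r 0 * Q * L * Real.exp (-(2 * L)) := by
    have e : r 0 * Q * L * Real.exp (-(2 * L)) = r 0 * Q * L * (1 - 2 * L * U₀) := by
      rw [hU₀eq]; ring
    rw [e]
    ring
  -- term-by-term bounds against `Q sL`
  have hQsL0 : 0 ≤ Q * sL := by positivity
  have b1 : 2 * (A₁ * U₀) ≤ CM * |r 0| * (Q * sL) := by
    have e : 2 * (A₁ * U₀) = CM * |r 0| * (Q * sL) * (2 * L * U₀) := by rw [hA₁]; ring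
    rw [e]
    exact mul_le_of_le_one_right (by positivity) hU₀le
  have b2 : 2 * (A₂ * U₁) ≤ (2 * CM * Cℓ + 2 * Cℓ) * (Q * sL) := by
    have h1 : L * sL * U₁ ≤ 1 := by
      calc L * sL * U₁ ≤ L * L * U₁ :=
            mul_le_mul_of_nonneg_right (mul_le_mul_of_nonneg_left hsLL hL0.le) hU₁0
        _ = L ^ 2 * U₁ := by ring
        _ ≤ 1 := hU₁le
    have e : 2 * (A₂ * U₁) = 2 * CM * Cℓ * Q * (L * sL * U₁) + 2 * Cℓ * Q * (L ^ 2 * U₁) := by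
      rw [hA₂]; ring
    rw [e]
    have h2 : 2 * CM * Cℓ * Q * (L * sL * U₁) ≤ 2 * CM * Cℓ * Q :=
      mul_le_of_le_one_right (by positivity) h1
    have h3 : 2 * Cℓ * Q * (L ^ 2 * U₁) ≤ 2 * Cℓ * Q := mul_le_of_le_one_right (by positivity) hU₁le
    have h4 : 2 * CM * Cℓ * Q ≤ 2 * CM * Cℓ * Q * sL := le_mul_of_one_le_right (by positivity) hsL1
    have h5 : 2 * Cℓ * Q ≤ 2 * Cℓ * Q * sL := le_mul_of_one_le_right (by positivity) hsL1
    have e2 : (2 * CM * Cℓ + 2 * Cℓ) * (Q * sL) = 2 * CM * Cℓ * Q * sL + 2 * Cℓ * Q * sL := by ring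
    linarith only [h2, h3, h4, h5, e2]
  have b3 : 2 * (A₃ * R₁) ≤ (2 * CM * R₁ + 4 * Real.pi * CM * R₁ + 2 * R₁) * (Q * sL) := by
    have hexp2 : L * sL * uδ ≤ 1 := by
      calc L * sL * uδ ≤ L * L * uδ :=
            mul_le_mul_of_nonneg_right (mul_le_mul_of_nonneg_left hsLL hL0.le) huδ0.le
        _ = L ^ 2 * uδ := by ring
        _ ≤ 1 := hexp1
    have e : 2 * (A₃ * R₁) = 2 * CM * R₁ * Q * (L * sL * uδ) + 4 * Real.pi * CM * R₁ * (Q * sL) +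
        2 * R₁ * Q * (L ^ 2 * uδ) := by
      rw [hA₃, hTQ]; ring
    rw [e]
    have h2 : 2 * CM * R₁ * Q * (L * sL * uδ) ≤ 2 * CM * R₁ * Q :=
      mul_le_of_le_one_right (by positivity) hexp2
    have h3 : 2 * R₁ * Q * (L ^ 2 * uδ) ≤ 2 * R₁ * Q := mul_le_of_le_one_right (by positivity) hexp1
    have h4 : 2 * CM * R₁ * Q ≤ 2 * CM * R₁ * Q * sL := le_mul_of_one_le_right (by positivity) hsL1
    have h5 : 2 * R₁ * Q ≤ 2 * R₁ * Q * sL := le_mul_of_one_le_right (by positivity) hsL1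
    have e2 : (2 * CM * R₁ + 4 * Real.pi * CM * R₁ + 2 * R₁) * (Q * sL) =
        2 * CM * R₁ * Q * sL + 4 * Real.pi * CM * R₁ * (Q * sL) + 2 * R₁ * Q * sL := by ring
    linarith only [h2, h3, h4, h5, e2]
  have b4 : 2 * A₄ ≤ 2 * |r 0| * (Q * sL) := by
    have e : 2 * A₄ = 2 * |r 0| * Q * (L ^ 2 * uδ) := by rw [hA₄]; ring
    rw [e]
    have h3 : 2 * |r 0| * Q * (L ^ 2 * uδ) ≤ 2 * |r 0| * Q := mul_le_of_le_one_right (by positivity) hexp1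
    have h5 : 2 * |r 0| * Q ≤ 2 * |r 0| * Q * sL := le_mul_of_one_le_right (by positivity) hsL1
    have e2 : 2 * |r 0| * (Q * sL) = 2 * |r 0| * Q * sL := by ring
    linarith only [h3, h5, e2]
  have b5 : |r 0 * Q * L * Real.exp (-(2 * L))| ≤ |r 0| * (Q * sL) := by
    rw [abs_mul, abs_of_pos (Real.exp_pos _), abs_mul, abs_of_pos hL0, abs_mul, abs_of_pos hQ0]
    have e : |r 0| * Q * L * Real.exp (-(2 * L)) = |r 0| * (Q * sL) * (sL * Real.exp (-(2 * L))) := by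
      rw [← hsL2]; ring
    rw [e]
    exact mul_le_of_le_one_right (by positivity) hexp3
  -- assemble
  rw [hD]
  refine (abs_sub _ _).trans ?_
  rw [abs_mul, abs_two]
  have h2 := mul_le_mul_of_nonneg_left hIle (by norm_num : (0 : ℝ) ≤ 2)
  have e : (CM * (|r 0| + 2 * Cℓ + 2 * R₁ + 4 * Real.pi * R₁) + 2 * Cℓ + 2 * R₁ + 3 * |r 0|) * (Q * sL) =
      CM * |r 0| * (Q * sL) + (2 * CM * Cℓ + 2 * Cℓ) * (Q * sL) +
        (2 * CM * R₁ + 4 * Real.pi * CM * R₁ + 2 * R₁) * (Q * sL) + 2 * |r 0| * (Q * sL) +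
        |r 0| * (Q * sL) := by ring
  linarith only [h2, b1, b2, b3, b4, b5, e]

/-! ## §4. Lemma 5 -/

/-- **Discharge of `baluyotEtAl2024_lemma5` — BGST 2024, Lemma 5 (pairs of zeros against an even kernel
of Fourier support `[−1,1]`, UNCONDITIONAL):** "Suppose `r(α)` is a real-valued even function in
`L¹(ℝ)` with support in `[−1,1]`, and also `r(α)` is Lipschitz continuous at `α = 0`. Then …
`Σ_{ρ,ρ′: 0<γ,γ′≤T} r̂(i(ρ−ρ′) log T/2π) w(ρ−ρ′) = (T/2π) log T (r(0) + 2∫₀¹ α r(α) dα + O(1/√log T))`"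
(3.5). Proof as printed (§3): (3.3) (`kernelPairSum_eq_integral`), evenness, the unconditional
Montgomery theorem on `0 ≤ α ≤ 1` (`pairSum_montgomeryTheorem`, in the authors' corrected 2025 form),
and the Lipschitz condition at `0` (`lemma5_core`). [cite: BaluyotEtAl2024, Lemma 5] -/
theorem _root_.Literature.NumberTheory.LFunctions.baluyotEtAl2024_lemma5_holds :
    baluyotEtAl2024_lemma5 := by
  intro r hev hint hsupp hlip
  obtain ⟨Cℓ₀, δ₀, hδ₀, hLip₀⟩ := hlip
  -- normalise the Lipschitz data: `Cℓ ≥ 0`, `0 < δ ≤ 1`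
  set Cℓ : ℝ := max Cℓ₀ 0 with hCℓ
  have hCℓ0 : 0 ≤ Cℓ := le_max_right _ _
  set δ : ℝ := min δ₀ 1 with hδdef
  have hδ : 0 < δ := lt_min hδ₀ one_pos
  have hLip : ∀ a : ℝ, |a| < δ → |r a - r 0| ≤ Cℓ * |a| := fun a ha ↦
    (hLip₀ a (lt_of_lt_of_le ha (min_le_left _ _))).trans
      (mul_le_mul_of_nonneg_right (le_max_left _ _) (abs_nonneg a))
  clear_value Cℓ δ
  -- the Montgomery theorem over `0 < γ ≤ T`, with a non-negative constant
  obtain ⟨CM₀, T₁, hMT⟩ := pairSum_montgomeryTheorem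
  set CM : ℝ := max CM₀ 0 with hCM
  have hCM0 : 0 ≤ CM := le_max_right _ _
  have hCMle : CM₀ ≤ CM := le_max_left _ _
  clear_value CM
  -- `r` vanishes off `[-1, 1]`
  have hr0 : ∀ a : ℝ, 1 < |a| → r a = 0 := fun a ha ↦ eq_zero_of_one_lt_abs hsupp ha
  have hrI : IntervalIntegrable r volume 0 1 := hint.intervalIntegrable
  -- the threshold
  set L₀ : ℝ := max 1 (4 / δ ^ 3) with hL₀
  refine ⟨CM * (|r 0| + 2 * Cℓ + 2 * (∫ a in (0 : ℝ)..1, |r a|) +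
      4 * Real.pi * (∫ a in (0 : ℝ)..1, |r a|)) + 2 * Cℓ + 2 * (∫ a in (0 : ℝ)..1, |r a|) + 3 * |r 0|,
    max (max T₁ 3) (Real.exp L₀), fun T hT ↦ ?_⟩
  have hT₁ : T₁ ≤ T := le_trans (le_trans (le_max_left _ _) (le_max_left _ _)) hT
  have hT3 : (3 : ℝ) ≤ T := le_trans (le_trans (le_max_right _ _) (le_max_left _ _)) hT
  have hTL₀ : Real.exp L₀ ≤ T := le_trans (le_max_right _ _) hT
  have hT0 : 0 < T := by linarith
  have hT1 : 1 ≤ T := by linarith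
  have hπ0 : 0 < Real.pi := Real.pi_pos
  -- `L = log T ≥ L₀ ≥ 1`, `sL = √L`, `Q = T/2π`
  set L : ℝ := Real.log T with hL
  have hLL₀ : L₀ ≤ L := by
    rw [hL, ← Real.log_exp L₀]; exact Real.log_le_log (Real.exp_pos _) hTL₀
  have hL1 : 1 ≤ L := le_trans (le_max_left _ _) hLL₀
  have hL0 : 0 < L := by linarith
  have hLδ : 4 / δ ^ 3 ≤ L := le_trans (le_max_right _ _) hLL₀
  set sL : ℝ := Real.sqrt L with hsL
  have hsL0 : 0 < sL := Real.sqrt_pos.2 hL0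
  have hsL2 : sL ^ 2 = L := Real.sq_sqrt hL0.le
  have hsL1 : 1 ≤ sL := by rw [hsL]; exact Real.one_le_sqrt.2 hL1
  have hsLL : sL ≤ L := by nlinarith only [hsL2, hsL1, hsL0]
  set Q : ℝ := T / (2 * Real.pi) with hQ
  have hQ0 : 0 < Q := by rw [hQ]; positivity
  have hTQ : T = 2 * Real.pi * Q := by rw [hQ]; field_simp
  -- exponential smallness
  have hexp1 : L ^ 2 * Real.exp (-(2 * δ * L)) ≤ 1 := sq_mul_exp_neg_le_one hδ hL0.le hLδ
  have hexp3 : sL * Real.exp (-(2 * L)) ≤ 1 := by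
    have h1 : L ≤ Real.exp (2 * L) := by linarith [Real.add_one_le_exp (2 * L)]
    rw [Real.exp_neg, mul_inv_le_iff₀ (Real.exp_pos _), one_mul]
    linarith
  -- the functions on `[0,1]`: `G(a) = F(T^a,T)`, `u(a) = T^{-2a}`
  set G : ℝ → ℝ := fun a ↦ (pairSum (T ^ a) T).re with hG
  set u : ℝ → ℝ := fun a ↦ Real.exp (-(2 * L * a)) with hu
  have hu0 : ∀ a, 0 < u a := fun a ↦ Real.exp_pos _
  -- `F(T^a, T)` is real: the complex integrand is `r(a) G(a)`
  have hFreal : ∀ a : ℝ, pairSum (T ^ a) T = ((G a : ℝ) : ℂ) := fun a ↦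
    Complex.ext (by simp [hG]) (by simp [pairSum_im (Real.rpow_pos_of_pos hT0 a) T])
  have hIC := integrable_mul_pairSum_rpow hint hsupp hT1
  have hIC' : (fun a : ℝ ↦ (r a : ℂ) * pairSum (T ^ a) T) = fun a ↦ ((r a * G a : ℝ) : ℂ) := by
    funext a; rw [hFreal a]; push_cast; ring
  have hh₁ : Integrable fun a : ℝ ↦ r a * G a := by
    have h := Complex.reCLM.integrable_comp hIC
    refine h.congr (ae_of_all _ fun a ↦ ?_)
    simp only [Complex.reCLM_apply]
    rw [hFreal a, ← Complex.ofReal_mul, Complex.ofReal_re]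
  have hh₁I : IntervalIntegrable (fun a : ℝ ↦ r a * G a) volume 0 1 := hh₁.intervalIntegrable
  -- `Σ r̂ w = ∫ r G = 2 ∫₀¹ r G`
  have hKP : kernelPairSum r T = ((∫ a, r a * G a : ℝ) : ℂ) := by
    rw [kernelPairSum_eq_integral hint hsupp hT1, hIC']
    exact integral_ofReal
  have hKJ : ∫ a, r a * G a = 2 * ∫ a in (0 : ℝ)..1, r a * G a := by
    refine integral_eq_two_mul_of_even (fun a ↦ ?_) (fun a ha ↦ ?_) hh₁I
    · simp only [hG]
      rw [hev, pairSum_rpow_neg hT0]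
    · have : r a = 0 := hr0 a (by rw [abs_of_pos (by linarith)]; exact ha)
      simp [this]
  -- (MT) on `[0,1]`
  have hMTa : ∀ a ∈ Set.Icc (0 : ℝ) 1,
      |G a - Q * (L ^ 2 * u a + a * L)| ≤ CM * (Q * L * sL * u a + T * sL) := by
    intro a ha
    have hx1 : 1 ≤ T ^ a := Real.one_le_rpow hT1 ha.1
    have hxT : T ^ a ≤ T := by
      calc T ^ a ≤ T ^ (1 : ℝ) := Real.rpow_le_rpow_of_exponent_le hT1 ha.2
        _ = T := Real.rpow_one T
    have h := hMT T hT₁ (T ^ a) hx1 hxT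
    rw [hFreal a, ← Complex.ofReal_sub, Complex.norm_real, Real.norm_eq_abs] at h
    have hxexp : T ^ a = Real.exp (L * a) := by rw [Real.rpow_def_of_pos hT0, hL]
    have hx2 : (T ^ a) ^ 2 = (u a)⁻¹ := by
      rw [hxexp]
      simp only [hu]
      rw [← Real.exp_neg, neg_neg, sq, ← Real.exp_add]
      ring_nf
    have hune : u a ≠ 0 := (hu0 a).ne'
    have hsLne : sL ≠ 0 := hsL0.ne'
    have hlogx : Real.log (T ^ a) = a * L := by rw [Real.log_rpow hT0, hL]
    have hmain : T / (2 * Real.pi * (T ^ a) ^ 2) * Real.log T ^ 2 +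
        T / (2 * Real.pi) * Real.log (T ^ a) = Q * (L ^ 2 * u a + a * L) := by
      rw [hlogx, ← hL, hx2, hQ]
      field_simp
    have herr : T / (2 * Real.pi * (T ^ a) ^ 2) * Real.log T ^ 2 / Real.sqrt (Real.log T) +
        T * Real.sqrt (Real.log T) = Q * L * sL * u a + T * sL := by
      rw [← hL, ← hsL, hx2, hQ, ← hsL2]
      field_simp
    rw [hmain, herr] at h
    refine h.trans (mul_le_mul_of_nonneg_right hCMle ?_)
    have := hu0 a
    positivity
  -- the core estimate and the conclusion
  have hcore := lemma5_core hCℓ0 hCM0 hQ0 hL0 hsL0 hsL2 hsL1 hsLL hTQ rfl hexp1 hexp3 hu hLip hrI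
    hh₁I hMTa
  have hrhs : T / (2 * Real.pi) * Real.log T / Real.sqrt (Real.log T) = Q * sL := by
    rw [← hL, ← hsL, ← hQ, div_eq_iff hsL0.ne', ← hsL2]
    ring
  rw [hKP, hKJ, hrhs, show ((T / (2 * Real.pi) * Real.log T * (r 0 + 2 * ∫ a in (0 : ℝ)..1, a * r a) : ℝ)
      : ℂ) = ((Q * L * (r 0 + 2 * ∫ a in (0 : ℝ)..1, a * r a) : ℝ) : ℂ) by rw [hQ, hL],
    ← Complex.ofReal_sub, Complex.norm_real, Real.norm_eq_abs]
  exact hcore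

end BGSTB2024

end Literature.NumberTheory.LFunctions

end
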